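import Literature.ComputerArithmetic.Shewchuk1997.FastExpansionSum
import Summits.Ventures.CertifiedArithmetic.Expansions.ScaleExpansionWitness

/-!
# SCALE-EXPANSION does not preserve the strongly nonoverlapping property:
# Corollary 22 of Shewchuk (1997) is false as printed

HONEST FRAMING (ENGINES group, unit `eng-quad-4`, kernels lane of the `certquad` engine — shared
numerical engines serving client cells; rigour lives in the verifiers; every published number
belongs to a client cell's ledger, not to the engines group): this is NEW WORK of the lane's Lean
line, not a published result, hence it lives under `Summits/Ventures/` and carries no citation tag of
its own.  The Literature file `Literature/ComputerArithmetic/Shewchuk1997/ScaleExpansion.lean` types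
§2.6 of [Shewchuk1997] (SCALE-EXPANSION, Theorem 19 with its nonadjacent addendum, Lemmas 20–21,
Theorem 18) and lists Corollary 22 as NOT TYPED; the companion file
`FastExpansionSumCounterexample.lean` of this directory refutes the printed Theorem 13.  An
exhaustive search over short four-bit inputs (integer model of round-to-even with an exact
two-product), re-derived by hand and then proved here for every precision (the run itself is
computed in the sibling file `ScaleExpansionWitness.lean`), shows that Corollary 22 is false as well.

THE PRINTED STATEMENT (J. R. Shewchuk, *Adaptive precision floating-point arithmetic and fast robust
geometric predicates*, Discrete Comput. Geom. 18 (1997) 305–363, Corollary 22, p. 330, in the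
setting of Theorem 19, p. 328: `e` a nonoverlapping expansion of `m` `p`-bit components sorted by
increasing magnitude except for zeros, `b` a `p`-bit value, `p ≥ 4`, `h = SCALE-EXPANSION(e, b)`
computed with an exact TWO-PRODUCT): "If e is strongly nonoverlapping and round-to-even tiebreaking
is used, then h is strongly nonoverlapping."

THE COUNTEREXAMPLE (every precision `p ≥ 3`; exponent floor `emin ≤ 0`, i.e. far from underflow;
round-to-even `BoldoJeannerodMelquiondMuller2023.roundTiesEven p emin`; ANY two-product routine
returning `(eᵢ ⊗ b, eᵢb − eᵢ ⊗ b)` on the three operands — Dekker's TWO-PRODUCT of Theorem 18, the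
FMA-based `twoProdFMA`, …).  Write `p = a + 2`, let `c + 2` be the even member of `{p, p + 1}`,
`M = (2^(c+2) − 1)/3` (binary `101…01`), `b = 3·2^a + 1`, and `e = ⟨M, 2^(c+2), −2^(c+3)⟩`:
three `p`-bit floats, strongly nonoverlapping (`2M < 2^(c+2)`; `2^(c+2)`, `−2^(c+3)` an isolated
adjacent pair of one-bit numbers; `isStrongExpansion_ce2E`) — but not nonadjacent, which is the case
Corollary 22 exists for.  The run (`scaleExpansion_ce2`): Line 1, `Mb = 2^(c+a+2) + (M − 2^a)` with
`0 < M − 2^a < 2^c = ulp/2`, so `Q₂ = 2^(c+a+2)` and `h₁ = M − 2^a` (`fl_ce2_prod`); `i = 2`: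
`T₂ = 2^(c+2)b` exactly, `t₂ = 0`, `Q₃ = Q₂`, `h₂ = 0`, and `T₂ + Q₃ = 2^(c+a+4) + 2^(c+2)` is the
exact midpoint of two consecutive floats of the binade `[2^(c+a+4), 2^(c+a+5))` (`ulp = 2^(c+3)`),
which round-to-even sends to the even neighbour `Q₄ = 2^(c+a+4)` (`roundTiesEven_ce2_tie`), leaving
`h₃ = 2^(c+2)`; `i = 3`: `T₃ = −2^(c+3)b` exactly, `t₃ = 0`, `h₄ = 0`, `Q₅ = Q₄`, and
`T₃ + Q₅ = −2^(c+3)(2^a + 1)` is a float, so `h₅ = 0` and `h₆ = Q₆ = −2^(c+3)(2^a + 1)`.  Output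
`h = ⟨M − 2^a, 0, 2^(c+2), 0, 0, −2^(c+3)(2^a + 1)⟩`: the components `2^(c+2)` and
`−2^(c+3)(2^a + 1)` are ADJACENT (`2·2^(c+2)` is the lowest set bit of the latter, whose significand
`2^a + 1` is odd) and `2^(c+3)(2^a + 1)` is not a power of two, so `h` is NOT strongly nonoverlapping
(`not_isStrongExpansion_ce2H`, `printedCorollary22_conclusion_false` and its `twoProdFMA` /
Dekker-`twoProduct` instances).  Smallest instance `p = 4`: `e = ⟨5, 16, −32⟩`, `b = 13`,
`h = ⟨1, 0, 16, 0, 0, −160⟩` (`65 → 64`, `208 + 64 = 272 → 256` by the even tie,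
`−416 + 256 = −160 = −5·2^5` exactly; `corollary22_counterexample_four`); `p = 3`: `⟨5, 16, −32⟩·7 =
⟨3, 0, 16, 0, 0, −96⟩`; `p = 53`: `c + 2 = 54`, `M = (2^54 − 1)/3`, `b = 3·2^51 + 1`.  As Theorem 19
demands, `h` IS a nonoverlapping expansion with `Σ hᵢ = b·Σ eᵢ` (`ce2H_isExpansion`, from the
Literature theorem `scaleExpansion_nonoverlapping`); only "strongly" fails.

WHERE THE PRINTED PROOF BREAKS (p. 330).  For an adjacent input pair `eᵢ = 2^s`, `eᵢ₊₁ = 2^(s+1)`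
(here `i = 2`, `s = c + 2`, `e₃ = −2^(s+1)`; signs play no role) it asserts: "The arguments used in
Theorem 19 to prove that h is nonadjacent, if e is nonadjacent and round-to-even tiebreaking is used,
can be applied here as well to show that h₂ᵢ₋₁ and h₂ᵢ₊₁ are not adjacent to any components of h
produced before or after them, but they may be adjacent to each other."  In the witness
`h₂ᵢ₋₁ = h₃ = 2^s` (the extreme case `|h₂ᵢ₋₁| = 2^s ulp(b)` of Lemma 21, `ulp(b) = 1`), `h₂ᵢ₊₁ = h₅ = 0`,
and `h₃` is adjacent to the component `h₆ = Q₆ = T₃ + Q₅ = −2^(s+1)(b − 2^(p−1))` produced AFTER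
them: the Theorem 19 argument needs `eᵢ₊₁` nonadjacent to `eᵢ`, which is exactly what fails for the
pair.  The offending later component need not be the final `h₂ₘ = Q₂ₘ` (Line 6): for `p = 4`,
`e = ⟨5, 16, −32, 256⟩`, `b = 13` gives `h = ⟨1, 0, 16, 0, 0, 0, 96, 3072⟩` with `16` adjacent to the
FAST-TWO-SUM roundoff `96 = 3·2^5` across three zeros (search output, re-derived by hand; not
formalised here).  In the searched range (`p = 4`; every strongly nonoverlapping `e` of at most four
nonzero components `±m·2^k`, `m` odd, `0 ≤ k ≤ 8`, up to a global sign; every odd four-bit `b`;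
82 480 runs): 71 failures (36 at the last component, 35 in the interior), none with `e` nonadjacent
(consistent with the nonadjacent addendum of Theorem 19, a theorem of the Literature file), and every
output nonoverlapping with the exact sum.

CONSEQUENCE.  As for Theorem 13: what §3–§4 of the paper use downstream is (i) `h` nonoverlapping
with `Σ hᵢ = b·Σ eᵢ` — intact (Theorem 19) — and (ii) that `h` may be fed to FAST-EXPANSION-SUM and
SCALE-EXPANSION again, whose printed input condition is "strongly nonoverlapping" — and that
re-entrancy is what breaks as stated: `⟨1, 0, 16, 0, 0, −160⟩` is a legitimate output that is not a
legitimate input of Theorem 13 / Corollary 22.  Whether the algorithms are nevertheless correct on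
all of their own outputs (a weaker invariant closed under both) is not decided here; nothing is
claimed about it.

PROVED HERE (0 sorry, no new definitions): `isStrongExpansion_ce2E`, `not_isStrongExpansion_ce2H`,
`ce2_exists`, `printedCorollary22_conclusion_false`, `printedCorollary22_conclusion_false_twoProdFMA`,
`printedCorollary22_conclusion_false_twoProduct`, `ce2H_isExpansion`, `corollary22_counterexample_four`;
the run itself (`scaleExpansion_ce2`, `fl_ce2_prod`, `roundTiesEven_ce2_tie`, float-ness of the
operands) is the sibling file `ScaleExpansionWitness.lean`.

References: [Shewchuk1997] Cor. 22 p. 330 and its proof pp. 330–331 with Fig. 14 (the statement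
refuted), Thm 19 p. 328, Thm 18 p. 327, Fig. 13 (the algorithm); the model, the algorithm
`scaleExpansion` and the true Theorem 19 are `Literature/ComputerArithmetic/Shewchuk1997/ScaleExpansion.lean`,
the strongly nonoverlapping property `IsStrongExpansion` is `…/FastExpansionSum.lean`.
-/

namespace Summit.Ventures.CertifiedArithmetic.Expansions

open Literature.ComputerArithmetic.JeannerodRump2018 (IsFloat IsRoundNearest isFloat_zero)
open Literature.ComputerArithmetic.BoldoJeannerodMelquiondMuller2023 (roundTiesEven ulp ulp_of_ne_zero
  isRoundNearest_roundTiesEven roundTiesEven_of_tie roundTiesEven_eq_self fl_eq_of_abs_sub_lt_half_ulp)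
open Literature.ComputerArithmetic.BoldoJeannerodMelquiondMuller2023 (twoProdFMA)
open Literature.ComputerArithmetic.GraillatMuller2025 (roundTiesEven_neg)
open Literature.ComputerArithmetic.Shewchuk1997

/-! ### The input is strongly nonoverlapping, the output is not -/

/-- `e = ⟨M, 2^(c+2), −2^(c+3)⟩` IS STRONGLY NONOVERLAPPING: `2M < 2^(c+2)` (so `M` is not even
adjacent to `2^(c+2)`), and `2^(c+2)`, `−2^(c+3)` are an adjacent pair of one-bit numbers, neither
adjacent to a third component (`M ≠ 2^(c+1)` since `3M + 1 = 2^(c+2)`). It is NOT nonadjacent. -/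
theorem isStrongExpansion_ce2E {a c : ℕ} (ha : 1 ≤ a) (hca : a ≤ c) (hc : c ≤ a + 1) {M : ℤ}
    (hM : 3 * M + 1 = 2 ^ (c + 2)) :
    IsStrongExpansion [(M : ℚ), 2 ^ (c + 2), -2 ^ (c + 3)] := by
  obtain ⟨-, -, hM0, -, h2M⟩ := ce2_bounds ha hca hc hM
  have hM0q : (0 : ℚ) < M := by exact_mod_cast hM0
  have h2Mq : 2 * (M : ℚ) < 2 ^ (c + 2) := by exact_mod_cast h2M
  have hMq : 3 * (M : ℚ) + 1 = 2 ^ (c + 2) := by exact_mod_cast hM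
  have e23 : (2 : ℚ) ^ (c + 3) = 2 * 2 ^ (c + 2) := by ring
  have hpos : (0 : ℚ) < 2 ^ (c + 2) := by positivity
  refine ⟨List.Pairwise.cons ?_ (List.Pairwise.cons ?_ (List.pairwise_singleton _ _)), ?_⟩
  · intro y hy
    simp only [List.mem_cons, List.not_mem_nil, or_false] at hy
    rcases hy with rfl | rfl
    · exact Or.inl ⟨((c + 2 : ℕ) : ℤ), ⟨1, by rw [zpow_natCast]; simp⟩,
        by rw [zpow_natCast, abs_of_pos hM0q]; linarith⟩
    · exact Or.inl ⟨((c + 3 : ℕ) : ℤ), ⟨-1, by rw [zpow_natCast]; simp⟩,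
        by rw [zpow_natCast, abs_of_pos hM0q, e23]; linarith⟩
  · intro y hy
    rw [List.mem_singleton.mp hy]
    refine Or.inr ⟨((c + 2 : ℕ) : ℤ), by rw [zpow_natCast, abs_of_pos hpos], ?_⟩
    rw [show ((c + 2 : ℕ) : ℤ) + 1 = ((c + 3 : ℕ) : ℤ) by push_cast; ring, zpow_natCast, abs_neg,
      abs_of_pos (by positivity)]
  · intro y hy hy0 h1 h2
    simp only [List.map_cons, List.map_nil, List.mem_cons, List.not_mem_nil, or_false] at hy h1 h2
    rcases hy with rfl | rfl | rfl
    · rw [abs_of_pos hM0q] at h1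
      rw [abs_of_pos hpos, abs_neg, abs_of_pos (by positivity)] at h1
      rcases h1 with h | h | h <;> linarith
    · rw [abs_of_pos hpos] at h1
      rw [abs_of_pos hM0q, abs_neg, abs_of_pos (by positivity)] at h1
      rcases h1 with h | h | h <;> linarith
    · rw [abs_neg, abs_of_pos (by positivity : (0 : ℚ) < 2 ^ (c + 3)), abs_of_pos hM0q,
        abs_of_pos hpos] at h2
      rcases h2 with h | h | h <;> linarith

/-- THE OUTPUT IS NOT STRONGLY NONOVERLAPPING: in `⟨M − 2^a, 0, 2^(c+2), 0, 0, −2^(c+3)·(2^a + 1)⟩`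
the components `2^(c+2)` and `−2^(c+3)·(2^a + 1)` are adjacent (`2·2^(c+2) = 2^(c+3)` is the lowest
set bit of the latter, whose significand `2^a + 1` is odd), and the latter is not a one-bit number. -/
theorem not_isStrongExpansion_ce2H (a c : ℕ) (ha : 1 ≤ a) (M : ℤ) :
    ¬ IsStrongExpansion [(M : ℚ) - 2 ^ a, 0, 2 ^ (c + 2), 0, 0, -(2 ^ (c + 3) * (2 ^ a + 1))] := by
  intro h
  have hpw := h.1
  rw [List.pairwise_cons] at hpw
  obtain ⟨-, hpw⟩ := hpw
  rw [List.pairwise_cons] at hpw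
  obtain ⟨-, hpw⟩ := hpw
  rw [List.pairwise_cons] at hpw
  obtain ⟨h3, -⟩ := hpw
  have h36 : StrongBelow ((2 : ℚ) ^ (c + 2)) (-(2 ^ (c + 3) * (2 ^ a + 1))) := h3 _ (by simp)
  have hodd : Odd (-(2 ^ a + 1) : ℤ) :=
    (((even_two).pow_of_ne_zero (by omega : a ≠ 0)).add_one).neg
  have hx : (-(2 ^ (c + 3) * (2 ^ a + 1)) : ℚ) = ((-(2 ^ a + 1) : ℤ) : ℚ) * (2 : ℚ) ^ ((c + 3 : ℕ) : ℤ) := by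
    rw [zpow_natCast]; push_cast; ring
  have e23 : (2 : ℚ) ^ (c + 3) = 2 * 2 ^ (c + 2) := by ring
  rcases h36 with ⟨s, hs, hlt⟩ | ⟨a', -, hc'⟩
  · rw [hx] at hs
    have hs1 : s ≤ ((c + 3 : ℕ) : ℤ) := OnGrid.le_of_odd hodd hs
    have h2s : (2 : ℚ) ^ s ≤ (2 : ℚ) ^ ((c + 3 : ℕ) : ℤ) := zpow_le_zpow_right₀ (by norm_num) hs1
    rw [zpow_natCast] at h2s
    rw [abs_of_pos (by positivity)] at hlt
    linarith
  · rw [hx] at hc'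
    have h1 := (abs_eq_one_of_odd_of_abs_eq_two_zpow hodd hc').1
    rw [abs_neg, abs_of_pos (by positivity)] at h1
    have : (1 : ℤ) ≤ 2 ^ a := one_le_pow₀ (by norm_num)
    linarith

/-! ### Parameters exist for every precision -/

/-- For every `a` there are `c ∈ {a, a + 1}` with `c + 2` even and the integer `M = (2^(c+2) − 1)/3`. -/
theorem ce2_exists (a : ℕ) : ∃ c : ℕ, ∃ M : ℤ, a ≤ c ∧ c ≤ a + 1 ∧ 3 * M + 1 = 2 ^ (c + 2) := by
  obtain ⟨n, hn1, hn2⟩ : ∃ n : ℕ, a + 2 ≤ 2 * n ∧ 2 * n ≤ a + 3 := ⟨(a + 3) / 2, by omega, by omega⟩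
  have key : ∀ k : ℕ, ∃ M : ℤ, 3 * M + 1 = 4 ^ k := by
    intro k
    induction k with
    | zero => exact ⟨0, by norm_num⟩
    | succ k ih =>
      obtain ⟨M, hM⟩ := ih
      exact ⟨4 * M + 1, by rw [pow_succ, ← hM]; ring⟩
  obtain ⟨M, hM⟩ := key n
  refine ⟨2 * n - 2, M, by omega, by omega, ?_⟩
  rw [show 2 * n - 2 + 2 = 2 * n by omega, pow_mul, show (2 : ℤ) ^ 2 = 4 by norm_num]
  exact hM

/-! ### Corollary 22 is false as printed -/

/-- **Corollary 22 of [Shewchuk1997] is false as printed**, for every precision `p ≥ 3`, every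
exponent floor `emin ≤ 0`, and EVERY two-product routine that returns `(eᵢ ⊗ b, eᵢb − eᵢ ⊗ b)` on
the operands (Dekker's TWO-PRODUCT of Theorem 18, an FMA, …): it is NOT the case that for every
strongly nonoverlapping expansion `e` of `p`-bit floats and every `p`-bit float `b` (here even with
the no-underflow side conditions of the formal Theorem 19, `b = M_b·2^k_b`, `eᵢ ∈ F ∩ F·2^(−k_b)`)
SCALE-EXPANSION under round-to-even returns a strongly nonoverlapping expansion.
Witness: `e = ⟨M, 2^(c+2), −2^(c+3)⟩`, `b = 3·2^(p−2) + 1` with `c + 2` the even member of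
`{p, p + 1}` and `M = (2^(c+2) − 1)/3`; output `⟨M − 2^(p−2), 0, 2^(c+2), 0, 0, −2^(c+3)·(2^(p−2) + 1)⟩`. -/
theorem printedCorollary22_conclusion_false {p : ℕ} (hp : 3 ≤ p) {emin : ℤ} (hemin : emin ≤ 0) :
    ¬ ∀ (tp : ℚ → ℚ → ℚ × ℚ) (e : List ℚ) (b : ℚ) (Mb kb : ℤ),
        b = (Mb : ℚ) * 2 ^ kb → |Mb| < 2 ^ p → IsFloat p emin b →
        (∀ x ∈ e, IsFloat p emin x) → (∀ x ∈ e, IsFloat p (emin - kb) x) → IsStrongExpansion e →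
        (∀ x ∈ e, (tp x b).1 = roundTiesEven p emin (x * b) ∧ (tp x b).1 + (tp x b).2 = x * b) →
        IsStrongExpansion (scaleExpansion tp (roundTiesEven p emin) e b) := by
  intro h
  obtain ⟨a, rfl⟩ : ∃ a, p = a + 2 := ⟨p - 2, by omega⟩
  have ha : 1 ≤ a := by omega
  obtain ⟨c, M, hca, hc, hM⟩ := ce2_exists a
  set tpI : ℚ → ℚ → ℚ × ℚ := fun x y =>
    (roundTiesEven (a + 2) emin (x * y), x * y - roundTiesEven (a + 2) emin (x * y)) with htpI_def
  have htpI : ∀ x ∈ [(M : ℚ), 2 ^ (c + 2), -2 ^ (c + 3)],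
      (tpI x (3 * 2 ^ a + 1)).1 = roundTiesEven (a + 2) emin (x * (3 * 2 ^ a + 1)) ∧
        (tpI x (3 * 2 ^ a + 1)).1 + (tpI x (3 * 2 ^ a + 1)).2 = x * (3 * 2 ^ a + 1) :=
    fun x _ => ⟨rfl, by simp [htpI_def]⟩
  have hrun := scaleExpansion_ce2 ha hca hc hM hemin htpI
  have hout := h tpI [(M : ℚ), 2 ^ (c + 2), -2 ^ (c + 3)] (3 * 2 ^ a + 1) (3 * 2 ^ a + 1) 0
    (by simp) (by exact_mod_cast ce2b_abs_lt ha) (ce2b_isFloat ha hemin) (ce2E_isFloat ha hca hc hM hemin)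
    (by rw [sub_zero]; exact ce2E_isFloat ha hca hc hM hemin) (isStrongExpansion_ce2E ha hca hc hM) htpI
  rw [hrun] at hout
  exact not_isStrongExpansion_ce2H a c ha M hout

/-- The same with the FMA-based exact two-product `twoProdFMA` [BoldoEtAl2023, Alg. 3] plugged in at
Lines 1 and 3 (it satisfies the two-product contract on these operands, `twoProdFMA_exact_of_rep`). -/
theorem printedCorollary22_conclusion_false_twoProdFMA {p : ℕ} (hp : 3 ≤ p) {emin : ℤ}
    (hemin : emin ≤ 0) :
    ¬ ∀ (e : List ℚ) (b : ℚ), (∀ x ∈ e, IsFloat p emin x) → IsFloat p emin b →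
        IsStrongExpansion e →
        IsStrongExpansion
          (scaleExpansion (twoProdFMA (roundTiesEven p emin)) (roundTiesEven p emin) e b) := by
  intro h
  obtain ⟨a, rfl⟩ : ∃ a, p = a + 2 := ⟨p - 2, by omega⟩
  have ha : 1 ≤ a := by omega
  have hp1 : 1 ≤ a + 2 := by omega
  obtain ⟨c, M, hca, hc, hM⟩ := ce2_exists a
  have hbrep : (3 * 2 ^ a + 1 : ℚ) = ((3 * 2 ^ a + 1 : ℤ) : ℚ) * 2 ^ (0 : ℤ) := by simp
  have htp : ∀ x ∈ [(M : ℚ), 2 ^ (c + 2), -2 ^ (c + 3)],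
      (twoProdFMA (roundTiesEven (a + 2) emin) x (3 * 2 ^ a + 1)).1 =
          roundTiesEven (a + 2) emin (x * (3 * 2 ^ a + 1)) ∧
        (twoProdFMA (roundTiesEven (a + 2) emin) x (3 * 2 ^ a + 1)).1 +
            (twoProdFMA (roundTiesEven (a + 2) emin) x (3 * 2 ^ a + 1)).2 = x * (3 * 2 ^ a + 1) :=
    fun x hx => twoProdFMA_exact_of_rep hp1 (isRoundNearest_roundTiesEven hp1) hbrep (ce2b_abs_lt ha)
      (by rw [sub_zero]; exact ce2E_isFloat ha hca hc hM hemin x hx)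
  have hrun := scaleExpansion_ce2 ha hca hc hM hemin htp
  have hout := h [(M : ℚ), 2 ^ (c + 2), -2 ^ (c + 3)] (3 * 2 ^ a + 1) (ce2E_isFloat ha hca hc hM hemin)
    (ce2b_isFloat ha hemin) (isStrongExpansion_ce2E ha hca hc hM)
  rw [hrun] at hout
  exact not_isStrongExpansion_ce2H a c ha M hout

/-- The same with **Shewchuk's own TWO-PRODUCT** (Theorem 18: Dekker's product with SPLIT at
`s = ⌈p/2⌉`, `p ≥ 4`) at Lines 1 and 3, far from underflow (`emin ≤ 1 − 2p`, so that every
`eᵢb` meets Lemma 5.23's normal-range condition): Theorem 18 makes it satisfy the two-product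
contract (`twoProduct_spec`), so the run and the failure are the same. -/
theorem printedCorollary22_conclusion_false_twoProduct {p : ℕ} (hp : 4 ≤ p) {s : ℕ}
    (hs2 : p ≤ 2 * s) (hs2' : 2 * s ≤ p + 1) {emin : ℤ} (hemin : emin + 2 * p ≤ 1) :
    ¬ ∀ (e : List ℚ) (b : ℚ), (∀ x ∈ e, IsFloat p emin x) → IsFloat p emin b →
        IsStrongExpansion e →
        IsStrongExpansion
          (scaleExpansion (twoProduct (roundTiesEven p emin) s) (roundTiesEven p emin) e b) := by
  intro h
  have hemin0 : emin ≤ 0 := by omega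
  obtain ⟨a, rfl⟩ : ∃ a, p = a + 2 := ⟨p - 2, by omega⟩
  have ha : 1 ≤ a := by omega
  have hp1 : 1 ≤ a + 2 := by omega
  obtain ⟨c, M, hca, hc, hM⟩ := ce2_exists a
  obtain ⟨hlo, -, hM0, -, -⟩ := ce2_bounds ha hca hc hM
  have hR := isRoundNearest_roundTiesEven (p := a + 2) (emin := emin) hp1
  have hsmall : (2 : ℚ) ^ (emin + ((a + 2 : ℕ) : ℤ) - 1) ≤ 1 :=
    zpow_le_one_of_nonpos₀ (by norm_num) (by push_cast; omega)
  have hsmall2 : (2 : ℚ) ^ (emin + 2 * ((a + 2 : ℕ) : ℤ) - 1) ≤ 1 :=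
    zpow_le_one_of_nonpos₀ (by norm_num) (by push_cast; omega)
  have hb1 : (1 : ℚ) ≤ |(3 * 2 ^ a + 1 : ℚ)| := by
    rw [abs_of_pos (by positivity)]
    have : (0 : ℚ) ≤ 2 ^ a := by positivity
    linarith
  have hx1 : ∀ x ∈ [(M : ℚ), 2 ^ (c + 2), -2 ^ (c + 3)], (1 : ℚ) ≤ |x| := by
    intro x hx
    simp only [List.mem_cons, List.not_mem_nil, or_false] at hx
    have hM1 : (1 : ℚ) ≤ M := by exact_mod_cast hM0
    rcases hx with rfl | rfl | rfl
    · rw [abs_of_pos (by exact_mod_cast hM0)]; exact hM1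
    · rw [abs_of_pos (by positivity)]; exact one_le_pow₀ (by norm_num)
    · rw [abs_neg, abs_of_pos (by positivity)]; exact one_le_pow₀ (by norm_num)
  have hnf : ∀ x ∈ [(M : ℚ), 2 ^ (c + 2), -2 ^ (c + 3)],
      x * (3 * 2 ^ a + 1) = 0 ∨ ((2 : ℚ) ^ (emin + ((a + 2 : ℕ) : ℤ) - 1) ≤ |x| ∧
        (2 : ℚ) ^ (emin + ((a + 2 : ℕ) : ℤ) - 1) ≤ |(3 * 2 ^ a + 1 : ℚ)| ∧
        (2 : ℚ) ^ (emin + 2 * ((a + 2 : ℕ) : ℤ) - 1) ≤ |x * (3 * 2 ^ a + 1)|) := by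
    intro x hx
    refine Or.inr ⟨hsmall.trans (hx1 x hx), hsmall.trans hb1, hsmall2.trans ?_⟩
    rw [abs_mul]
    nlinarith [hx1 x hx, hb1]
  have htp : ∀ x ∈ [(M : ℚ), 2 ^ (c + 2), -2 ^ (c + 3)],
      (twoProduct (roundTiesEven (a + 2) emin) s x (3 * 2 ^ a + 1)).1 =
          roundTiesEven (a + 2) emin (x * (3 * 2 ^ a + 1)) ∧
        (twoProduct (roundTiesEven (a + 2) emin) s x (3 * 2 ^ a + 1)).1 +
            (twoProduct (roundTiesEven (a + 2) emin) s x (3 * 2 ^ a + 1)).2 = x * (3 * 2 ^ a + 1) :=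
    fun x hx =>
      let hsp := twoProduct_spec hp hs2 hs2' hR roundTiesEven_neg (roundoffBelow_one hp1 hR)
        (ce2E_isFloat ha hca hc hM hemin0 x hx) (ce2b_isFloat ha hemin0) (hnf x hx)
      ⟨hsp.1, hsp.2.1⟩
  have hrun := scaleExpansion_ce2 ha hca hc hM hemin0 htp
  have hout := h [(M : ℚ), 2 ^ (c + 2), -2 ^ (c + 3)] (3 * 2 ^ a + 1) (ce2E_isFloat ha hca hc hM hemin0)
    (ce2b_isFloat ha hemin0) (isStrongExpansion_ce2E ha hca hc hM)
  rw [hrun] at hout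
  exact not_isStrongExpansion_ce2H a c ha M hout

/-- What Theorem 19 itself guarantees does hold for the witness (it is a theorem of the Literature
file for any contract-abiding two-product): the output `⟨M − 2^a, 0, 2^(c+2), 0, 0, −2^(c+3)·(2^a + 1)⟩`
IS a nonoverlapping expansion (`IsExpansion 1`) whose sum is `b·Σ eᵢ`. Only "strongly" fails. -/
theorem ce2H_isExpansion {a c : ℕ} (ha : 1 ≤ a) (hca : a ≤ c) (hc : c ≤ a + 1) {M : ℤ}
    (hM : 3 * M + 1 = 2 ^ (c + 2)) :
    IsExpansion 1 [(M : ℚ) - 2 ^ a, 0, 2 ^ (c + 2), 0, 0, -(2 ^ (c + 3) * (2 ^ a + 1))] ∧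
      [(M : ℚ) - 2 ^ a, 0, 2 ^ (c + 2), 0, 0, -(2 ^ (c + 3) * (2 ^ a + 1))].sum =
        [(M : ℚ), 2 ^ (c + 2), -2 ^ (c + 3)].sum * (3 * 2 ^ a + 1) := by
  have hp1 : 1 ≤ a + 2 := by omega
  set tpI : ℚ → ℚ → ℚ × ℚ := fun x y =>
    (roundTiesEven (a + 2) 0 (x * y), x * y - roundTiesEven (a + 2) 0 (x * y)) with htpI_def
  have htpI : ∀ x ∈ [(M : ℚ), 2 ^ (c + 2), -2 ^ (c + 3)],
      (tpI x (3 * 2 ^ a + 1)).1 = roundTiesEven (a + 2) 0 (x * (3 * 2 ^ a + 1)) ∧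
        (tpI x (3 * 2 ^ a + 1)).1 + (tpI x (3 * 2 ^ a + 1)).2 = x * (3 * 2 ^ a + 1) :=
    fun x _ => ⟨rfl, by simp [htpI_def]⟩
  have hrun := scaleExpansion_ce2 ha hca hc hM le_rfl htpI
  have hbrep : (3 * 2 ^ a + 1 : ℚ) = ((3 * 2 ^ a + 1 : ℤ) : ℚ) * 2 ^ (0 : ℤ) := by simp
  have h19 := scaleExpansion_nonoverlapping hp1 (isRoundNearest_roundTiesEven hp1) hbrep (ce2b_abs_lt ha)
    (ce2E_isFloat ha hca hc hM le_rfl) (by rw [sub_zero]; exact ce2E_isFloat ha hca hc hM le_rfl)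
    (isStrongExpansion_ce2E ha hca hc hM).isExpansion htpI
  rw [hrun] at h19
  exact ⟨h19.1, h19.2.1⟩

/-! ### The smallest instance, `p = 4`: `e = ⟨5, 16, −32⟩`, `b = 13`, `h = ⟨1, 0, 16, 0, 0, −160⟩` -/

/-- `p = 4` (`a = c = 2`, `M = 5`): SCALE-EXPANSION(`⟨5, 16, −32⟩`, `13`) `= ⟨1, 0, 16, 0, 0, −160⟩`
under round-to-even with any contract-abiding two-product (`5·13 = 65 → 64`, `16·13 + 64 = 272 → 256`
by the even tie, `−32·13 + 256 = −160` exactly), and `16`, `−160 = −5·2^5` are adjacent with `160` not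
a power of two: the output is not strongly nonoverlapping although the input is. -/
theorem corollary22_counterexample_four {emin : ℤ} (hemin : emin ≤ 0) {tp : ℚ → ℚ → ℚ × ℚ}
    (htp : ∀ x ∈ [(5 : ℚ), 16, -32],
      (tp x 13).1 = roundTiesEven 4 emin (x * 13) ∧ (tp x 13).1 + (tp x 13).2 = x * 13) :
    IsStrongExpansion [(5 : ℚ), 16, -32] ∧
      scaleExpansion tp (roundTiesEven 4 emin) [5, 16, -32] 13 = [1, 0, 16, 0, 0, -160] ∧
      ¬ IsStrongExpansion [(1 : ℚ), 0, 16, 0, 0, -160] := by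
  have hM : 3 * (5 : ℤ) + 1 = 2 ^ (2 + 2) := by norm_num
  have he := isStrongExpansion_ce2E (a := 2) (c := 2) (by norm_num) (by norm_num) (by norm_num) hM
  have hn := not_isStrongExpansion_ce2H 2 2 (by norm_num) 5
  have htp' : ∀ x ∈ [((5 : ℤ) : ℚ), 2 ^ (2 + 2), -2 ^ (2 + 3)],
      (tp x (3 * 2 ^ 2 + 1)).1 = roundTiesEven (2 + 2) emin (x * (3 * 2 ^ 2 + 1)) ∧
        (tp x (3 * 2 ^ 2 + 1)).1 + (tp x (3 * 2 ^ 2 + 1)).2 = x * (3 * 2 ^ 2 + 1) := by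
    have h5 := htp 5 (by simp)
    have h16 := htp 16 (by simp)
    have h32 := htp (-32) (by simp)
    norm_num at h5 h16 h32 ⊢
    exact ⟨h5, h16, h32⟩
  have hrun := scaleExpansion_ce2 (a := 2) (c := 2) (by norm_num) (by norm_num) (by norm_num) hM hemin htp'
  norm_num at he hn hrun
  exact ⟨he, hrun, hn⟩

end Summit.Ventures.CertifiedArithmetic.Expansions
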